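import Literature.AlgebraicGeometry.ModuliOfAbelianVarieties.SiegelPrincipalLevelArithmeticGroup
import Literature.AlgebraicGeometry.ModuliOfAbelianVarieties.SymplecticTypeFormStrongApproximation
import Literature.AlgebraicGeometry.ModuliOfAbelianVarieties.SiegelShimuraSetIndexRepresentatives
import Literature.AlgebraicGeometry.ModuliOfAbelianVarieties.SiegelHalfSwap
import Literature.NumberTheory.Adeles.RatFiniteIdeleCongruenceClasses
import HarnessLib

/-!
# The principal dissection of the Siegel Shimura set at level `K_δ(N)`:
# `Sh_{K_δ(N)}(GSp_δ, S^±)(ℂ) ≃ ∐_{u ∈ ẑ^×/(ẑ^× ∩ (1+Nẑ))} Γ_δ(N)∖𝔥_g` ([Milne ISV] Lemma 5.13 / Thm. 5.17 for `GSp_δ`;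
# [MFK94] App. 7A «`𝒜_{g,1,n} × Spec ℂ ≅ ∐ 𝔥_g/Γ_n`»)

Topic `AlgebraicGeometry/ModuliOfAbelianVarieties`; namespace `Literature.AlgebraicGeometry.ModuliOfAbelianVarieties`.
THEOREMS ONLY (no definition, no named fact, no instance, no `sorry`).  Cell hodgecm-mathlib (D-0151), #60 road
(`SiegelS1`) leaf R60-27 (A-p05 TABLE v1.6: «one-level capstone assembler»): the complex points of the Siegel modular
variety at a principal level `K_δ(N)`, `N ≥ 3`, as a FINITE DISJOINT UNION of copies of `Γ_δ(N)∖𝔥_g` indexed by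
`(ℤ/N)^× ≅ ẑ^×/(ẑ^× ∩ (1+Nẑ))`, with INTEGRAL representatives `r_c = diag(1_g, u_c·1_g) ∈ K_δ(1) = GSp_δ(ℤ̂)` — exactly
the shape the hypothesis structure ★ (σ3) `SiegelComplexRecordSystem` records at one level (`Q K` finite, `rep K q`,
`pts`, `incl_unif`), read on a Siegel fine moduli datum `D : SiegelModuliDatum g δ N` (whose `D.S(ℂ) = Γ_δ(N)∖𝔥_g`,
★ `SiegelModuliDatum.unif_eq_unif_iff_exists_smul`).  HC_CM is proved only modulo the 7 printed citations until rung 0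
closes; this file proves no cell binder (books 0).

## The mathematics (printed)

[Milne2005ShimuraVarieties] Lemma 5.13 p. 57: «`Sh_K(G,X)(ℂ) ≅ ⨆_{g ∈ 𝒞} Γ_g∖X⁺`, `𝒞` a set of representatives for
`G(ℚ)₊∖G(𝔸_f)/K`», with (5.2) / Lemma 5.12 / Thm. 5.17 p. 59 «`π₀(Sh_K) ≅ T(ℚ)†∖T(𝔸_f)/ν(K)`» (here `G = GSp_δ`, `T = 𝔾_m`,
`ν` the multiplier, `ν(K_δ(N)) = ẑ^× ∩ (1+Nẑ)`, `ℚ_{>0}∖𝔸_{ℚ,f}^×/(ẑ^× ∩ (1+Nẑ)) ≅ (ℤ/N)^×`); §6 p. 70 (the Siegel modular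
variety); [MumfordFogartyKirwan1994] Appendix 7A; [Deligne1971TravauxShimura] Exemple 4.16 p. 150.  The assembly consumes,
BY NAME: ★ R60-11 (`SiegelPrincipalLevelArithmeticGroup`: the fibres of `Z ↦ [J(Z), rK_δ(N)]` are the `Γ_δ(N)`-orbits /
the fibres of `D.unif`), ★ R60-13 (`SiegelShimuraSetDissection`: `mk_mul_of_mem`), ★ `SiegelHalfSwap` (`X⁻ → X⁺`), ★ R60-4
(`SiegelPrincipalLevelMultiplier`: `ν(K_δ(N)) = ẑ^× ∩ (1+Nẑ)` both ways), ★ R60-20 (`SymplecticSimilitudeMultiplierSection`: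
uniqueness of `ν`, the section `u ↦ diag(1,u)`), ★ R60-12 (`NumberTheory/Adeles/RatFiniteIdeleCongruenceClasses`: the
idèle-class invariant in `(ℤ/N)^×`), ★ R60-21B′ (`SiegelShimuraSetIndexRepresentatives`: `ẑ`-units are `≡ 1 (mod 1·𝓞̂)`), and STRONG
APPROXIMATION for `Sp_δ` (★ R60-8 `StrongApproximationSp` via ★ R60-8c `SymplecticTypeFormStrongApproximation`:
`exists_gspRational_mul_mem_of_isOpen`, «`Sp_δ(𝔸_f) = Sp_δ(ℚ)·U`»), sharpened here (§3a) to the two-point form «two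
points with a common multiplier differ by `Sp_δ(ℚ)` on the left and `K_δ(N)` on the right».

* §1 `exists_principalRep`: for `c ∈ (ℤ/N)^×` an idèle `u_c ∈ ẑ^×` with residue `c` (★ R60-12) and `r_c ∈ K_δ(1)` with
  multiplier `u_c` and matrix `diag(1_g, u_c·1_g)` (★ R60-4 at level `1`, ★ R60-21B′).
* §2 DISJOINTNESS `intCast_dvd_sub_of_mk_jOfSiegel_eq_mk_jOfSiegel`: for integral representatives `r, r′ ∈ K_δ(1)` with unit
  multipliers `u, u′` of residues `a, a′` and `Z, Z′ ∈ 𝔥_g`, `[J(Z), rK_δ(N)] = [J(Z′), r′K_δ(N)] ⇒ a ≡ a′ (mod N)` — the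
  transporter `γ ∈ GSp_δ(ℚ)` lies in `K_δ(1)`, so `det γ = ±1`, `ν(γ) = ±1` (★ R60-11), and `ν(γ) = -1` would move `X⁺` to `X⁻`
  (★ `neg_conjJ_mem_C0_of_neg`); then `ν(r′⁻¹γ⁻¹r) = u′⁻¹u ≡ 1 (mod N)` (★ R60-4).
* §3 SURJECTIVITY `exists_eq_mk_jOfSiegel_of_mem_C0` / `exists_eq_mk_jOfSiegel`: every class is `[J(Z), r_cK_δ(N)]` —
  normalise `ν(a) = q·u_c·w` (★ R60-12), move by `diag(1,q) ∈ GSp_δ(ℚ)` (`q > 0`) and `diag(1,w) ∈ K_δ(N)`, then by §3a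
  `a′ = γ r_c k` with `γ ∈ Sp_δ(ℚ)`, so `[J, a] = [γ′⁻¹•J, r_c]` with `ν(γ′) = q > 0`, `γ′⁻¹•J ∈ X⁺ = J(𝔥_g)`; a class with
  `J ∈ X⁻` is first moved to `X⁺` by the half-swap (★ `SiegelHalfSwap`).
* §4 HEAD `SiegelModuliDatum.exists_sigma_equiv_siegelShimuraSet`: for `D : SiegelModuliDatum g δ N` a bijection
  `(Σ c : (ℤ/N)^×, D.S(ℂ)) ≃ Sh_{K_δ(N)}(ℂ)` with `⟨c, D.unif Z⟩ ↦ [J(Z), r_cK_δ(N)]` (injective on each piece by ★ R60-11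
  `mk_jOfSiegel_eq_mk_jOfSiegel_iff_unif_eq_unif`).

## References
* [Milne2005ShimuraVarieties] J. S. Milne, *Introduction to Shimura varieties* (2005), §5 (5.2), Lemma 5.12, Lemma 5.13 p. 57,
  Thm. 5.17 p. 59; §6 p. 70.
* [MumfordFogartyKirwan1994] D. Mumford, J. Fogarty, F. Kirwan, *Geometric Invariant Theory*, Appendix to Ch. 7 §A.
* [Deligne1971TravauxShimura] P. Deligne, *Travaux de Shimura* (1971), Exemple 4.16 p. 150, 1.8 p. 129.
-/

set_option autoImplicit false

noncomputable section

open Matrix NumberField IsDedekindDomain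

namespace Literature.AlgebraicGeometry.ModuliOfAbelianVarieties

open SiegelModuli
open Literature.NumberTheory.Automorphic (siegelUpperHalfSpace)
open Literature.NumberTheory.Adeles

variable {g : ℕ} {δ : Fin g → ℕ}

/-! ### §1. Integral representatives `r_c = diag(1_g, u_c·1_g) ∈ K_δ(1)`, `u_c ∈ ẑ^×` of residue `c ∈ (ℤ/N)^×` -/

section Representatives

/-- **Integral representatives**: for `N ≠ 0` and every class `c ∈ (ℤ/N)^×` there are a `ẑ`-unit `u_c` with residue `c`
(`u_c ≡ c.val (mod N·ẑ)`, ★ R60-12 `exists_units_forall_valued_eq_one_sub_intCast_mem_levelIdeal`) and an element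
`r_c ∈ K_δ(1) = GSp_δ(ℤ̂)` with multiplier `u_c` and matrix `diag(1_g, u_c·1_g)` (★ R60-4 at level `1`) — Milne's
representatives `𝒞` for `GSp_δ` at principal level. [cite: Milne2005ShimuraVarieties, §5 (5.2) and Lemma 5.13 p. 57]
[cite: Deligne1971TravauxShimura, Exemple 4.16 p. 150] -/
theorem exists_principalRep (δ : Fin g → ℕ) {N : ℕ} (hN : N ≠ 0) (c : (ZMod N)ˣ) :
    ∃ (u : finAdeleQˣ) (r : gspFinAdelic δ), (∀ v, Valued.v ((u : finAdeleQ) v) = 1) ∧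
      (u : finAdeleQ) - ((c : ZMod N).val : ℕ) ∈ levelIdeal N ∧ r ∈ principalLevelSubgroup δ 1 ∧
        IsMultiplier (typeFormOver δ finAdeleQ) (r : GL (Fin g ⊕ Fin g) finAdeleQ) u ∧
          ((r : GL (Fin g ⊕ Fin g) finAdeleQ) : Matrix (Fin g ⊕ Fin g) (Fin g ⊕ Fin g) finAdeleQ) =
            Matrix.fromBlocks 1 0 0 ((u : finAdeleQ) • (1 : Matrix (Fin g) (Fin g) finAdeleQ)) := by
  have hcop : IsCoprime (((c : ZMod N).val : ℕ) : ℤ) (N : ℤ) :=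
    Nat.isCoprime_iff_coprime.2 (ZMod.val_coe_unit_coprime c)
  obtain ⟨u, hu, hua⟩ := exists_units_forall_valued_eq_one_sub_intCast_mem_levelIdeal hN hcop
  obtain ⟨r, hr, hru, hrmat⟩ := exists_mem_principalLevelSubgroup_isMultiplier δ u
    (sub_one_mem_levelIdeal_one_of_forall_valued_eq_one hu).1 (sub_one_mem_levelIdeal_one_of_forall_valued_eq_one hu).2
  refine ⟨u, r, hu, ?_, hr, hru, hrmat⟩
  rw [Int.cast_natCast] at hua
  exact hua

end Representatives

/-! ### §2. Disjointness: classes on `X⁺` with integral representatives of different residues are different -/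

section Disjoint

/-- The rational point `γ ∈ GSp_δ(ℚ)` transporting two classes `[J, rK_δ(N)] = [J′, r′K_δ(N)]` with INTEGRAL representatives
`r, r′ ∈ K_δ(1)`: `γ = r k⁻¹ r′⁻¹` is adelically integral (`γ ∈ K_δ(1)`), and `k := (γr′)⁻¹ r ∈ K_δ(N)`.
[cite: Milne2005ShimuraVarieties, Lemma 5.13 p. 57 (footnotes 40–41)] -/
theorem exists_rational_of_mk_eq_mk_of_mem_one {N : ℕ} {r r' : gspFinAdelic δ} (hr : r ∈ principalLevelSubgroup δ 1)
    (hr' : r' ∈ principalLevelSubgroup δ 1) {J J' : C0pm δ}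
    (h : SiegelShimuraSet.mk δ (principalLevelSubgroup δ N) J r = SiegelShimuraSet.mk δ (principalLevelSubgroup δ N) J' r') :
    ∃ γ : gspRational δ, conjAct δ (gspRationalToReal δ γ) J' = J ∧
      (gspRationalToFinAdelic δ γ * r')⁻¹ * r ∈ principalLevelSubgroup δ N ∧
        gspRationalToFinAdelic δ γ ∈ principalLevelSubgroup δ 1 := by
  obtain ⟨γ, hJ, hq⟩ := (SiegelShimuraSet.mk_eq_mk_iff δ _ J J' r r').1 h
  rw [MulAction.Quotient.smul_mk, QuotientGroup.eq, smul_eq_mul] at hq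
  refine ⟨γ, hJ, hq, ?_⟩
  have hk1 : (gspRationalToFinAdelic δ γ * r')⁻¹ * r ∈ principalLevelSubgroup δ 1 :=
    principalLevelSubgroup_anti δ (one_dvd N) hq
  have e : gspRationalToFinAdelic δ γ = r * ((gspRationalToFinAdelic δ γ * r')⁻¹ * r)⁻¹ * r'⁻¹ := by group
  rw [e]
  exact mul_mem (mul_mem hr (inv_mem hk1)) (inv_mem hr')

/-- A rational similitude which is adelically integral with integral inverse (`γ ∈ K_δ(1)`) and which maps a point of
`X⁺` into `X⁺` has multiplier `1` (`det γ = ±1` gives `ν = ±1`, ★ R60-11; `ν = -1` would swap the halves,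
★ `neg_conjJ_mem_C0_of_neg`; `g ≥ 1`, `δ` a polarisation type). [cite: Milne2005ShimuraVarieties, §6 p. 68 and Lemma 5.13 p. 57] -/
theorem multiplier_eq_one_of_mem_one_of_conjAct_mem_C0 (hδ : IsPolarizationType δ) (hg : 0 < g) {γ : gspRational δ}
    (hγ : gspRationalToFinAdelic δ γ ∈ principalLevelSubgroup δ 1) {ν : ℚˣ}
    (hν : IsMultiplier (typeFormOver δ ℚ) (γ : GL (Fin g ⊕ Fin g) ℚ) ν) {J J' : C0pm δ}
    (hJ' : (J' : Matrix (Fin g ⊕ Fin g) (Fin g ⊕ Fin g) ℝ) ∈ C0 δ) (hJ : (J : Matrix (Fin g ⊕ Fin g) (Fin g ⊕ Fin g) ℝ) ∈ C0 δ)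
    (h : conjAct δ (gspRationalToReal δ γ) J' = J) : ν = 1 := by
  obtain ⟨h1, h2⟩ := (mem_principalLevelSubgroup_iff δ).1 hγ
  rw [coe_gspRationalToFinAdelic] at h1
  change IsCongOne 1 (((Matrix.GeneralLinearGroup.map (algebraMap ℚ finAdeleQ) (γ : GL (Fin g ⊕ Fin g) ℚ))⁻¹ :
    GL (Fin g ⊕ Fin g) finAdeleQ) : Matrix (Fin g ⊕ Fin g) (Fin g ⊕ Fin g) finAdeleQ) at h2
  have hdet := det_eq_one_or_eq_neg_one_of_isCongOne (γ : GL (Fin g ⊕ Fin g) ℚ) 1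
    (by rw [inv_one, one_mul, mul_one]; exact h1) (by rw [inv_one, one_mul, mul_one]; exact h2)
  rcases multiplier_eq_one_or_eq_neg_one_of_det hδ.1 hg hν hdet with hν1 | hν1
  · exact Units.ext hν1
  · exfalso
    -- the real multiplier is `-1 < 0`: `γ` swaps `X⁺` and `X⁻`
    have hνR : IsMultiplier (realTypeForm δ) ((gspRationalToReal δ γ : gspReal δ) : GL (Fin g ⊕ Fin g) ℝ)
        (Units.map (algebraMap ℚ ℝ).toMonoidHom ν) := by
      have := hν.map (algebraMap ℚ ℝ)
      rwa [typeFormOver_map, typeFormOver_real_eq_realTypeForm] at this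
    have hneg : ((Units.map (algebraMap ℚ ℝ).toMonoidHom ν : ℝˣ) : ℝ) < 0 := by
      change algebraMap ℚ ℝ (ν : ℚ) < 0
      rw [hν1, map_neg, map_one]
      norm_num
    have hC := neg_conjJ_mem_C0_of_neg hνR hneg hJ'
    have hJJ : conjJ ((gspRationalToReal δ γ : gspReal δ) : GL (Fin g ⊕ Fin g) ℝ) (J' : Matrix _ _ ℝ) =
        (J : Matrix (Fin g ⊕ Fin g) (Fin g ⊕ Fin g) ℝ) := by
      rw [← coe_conjAct, h]
    rw [hJJ] at hC
    exact neg_not_mem_C0_of_mem_C0 hg hJ hC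

/-- **DISJOINTNESS of the `X⁺`-pieces with integral representatives of different residues** ([Milne ISV] Lemma 5.13 / 5.12
for `GSp_δ`: the piece is read by the multiplier modulo `ℚ^×·ν(K_δ(N))`; on `X⁺` with `r, r′ ∈ K_δ(1)` the rational factor
is `1`): if `r, r′ ∈ K_δ(1)` have unit multipliers `u, u′` with `u′ ∈ ẑ^×`, of residues `a, a′` modulo `N·ẑ`, and
`[J(Z), rK_δ(N)] = [J(Z′), r′K_δ(N)]` for some `Z, Z′ ∈ 𝔥_g`, then `N ∣ a - a′`.
[cite: Milne2005ShimuraVarieties, Lemma 5.12 p. 57, Lemma 5.13 p. 57, Thm. 5.17 p. 59] [cite: Deligne1971TravauxShimura, Exemple 4.16 p. 150] -/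
theorem intCast_dvd_sub_of_mk_jOfSiegel_eq_mk_jOfSiegel (hδ : IsPolarizationType δ) (hg : 0 < g) {N : ℕ} (hN : N ≠ 0)
    {r r' : gspFinAdelic δ} (hr : r ∈ principalLevelSubgroup δ 1) (hr' : r' ∈ principalLevelSubgroup δ 1)
    {u u' : finAdeleQˣ} (hu : IsMultiplier (typeFormOver δ finAdeleQ) (r : GL (Fin g ⊕ Fin g) finAdeleQ) u)
    (hu' : IsMultiplier (typeFormOver δ finAdeleQ) (r' : GL (Fin g ⊕ Fin g) finAdeleQ) u')
    (hu'int : ∀ v, Valued.v ((u' : finAdeleQ) v) = 1) {a a' : ℤ} (ha : (u : finAdeleQ) - a ∈ levelIdeal N)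
    (ha' : (u' : finAdeleQ) - a' ∈ levelIdeal N) {Z Z' : siegelUpperHalfSpace g}
    (h : SiegelShimuraSet.mk δ (principalLevelSubgroup δ N) ⟨jOfSiegel δ Z, jOfSiegel_coe_mem_C0pm hδ.1 Z⟩ r =
      SiegelShimuraSet.mk δ (principalLevelSubgroup δ N) ⟨jOfSiegel δ Z', jOfSiegel_coe_mem_C0pm hδ.1 Z'⟩ r') :
    (N : ℤ) ∣ a - a' := by
  obtain ⟨γ, hJ, hk, hγ1⟩ := exists_rational_of_mk_eq_mk_of_mem_one hr hr' h
  obtain ⟨ν, hν⟩ := γ.2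
  have hν1 : ν = 1 := multiplier_eq_one_of_mem_one_of_conjAct_mem_C0 hδ hg hγ1 hν
    (jOfSiegel_mem_C0 hδ.1 Z'.2) (jOfSiegel_mem_C0 hδ.1 Z.2) hJ
  -- adelic multipliers: `ν(γ_𝔸) = 1`, `ν(k) = (1·u′)⁻¹ · u`
  have hγA : IsMultiplier (typeFormOver δ finAdeleQ)
      ((gspRationalToFinAdelic δ γ : gspFinAdelic δ) : GL (Fin g ⊕ Fin g) finAdeleQ) 1 := by
    have := hν.map (algebraMap ℚ finAdeleQ)
    rw [typeFormOver_map, hν1, map_one] at this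
    exact this
  have hkmul : IsMultiplier (typeFormOver δ finAdeleQ)
      (((gspRationalToFinAdelic δ γ * r')⁻¹ * r : gspFinAdelic δ) : GL (Fin g ⊕ Fin g) finAdeleQ) ((1 * u')⁻¹ * u) :=
    (hγA.mul hu').inv.mul hu
  have hcong := (sub_one_mem_levelIdeal_of_isMultiplier_of_isPolarizationType δ hδ hg hk hkmul).1
  rw [one_mul] at hcong
  -- `u′ · (u′⁻¹ u - 1) = u - u′ ∈ N·ẑ`
  have hsub : (u : finAdeleQ) - u' ∈ levelIdeal N := by
    have e : (u : finAdeleQ) - u' = (u' : finAdeleQ) * ((((u'⁻¹ * u : finAdeleQˣ)) : finAdeleQ) - 1) := by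
      rw [Units.val_mul, mul_sub, mul_one, ← mul_assoc, Units.mul_inv, one_mul]
    rw [e]
    exact mul_mem_levelIdeal_of_mem_integralAdeles
      (Literature.NumberTheory.Adeles.mem_integralAdeles_of_forall_valued_eq_one hu'int) hcong
  -- hence `a - a′ ∈ N·ẑ ∩ ℤ = Nℤ`
  have hmem : ((a - a' : ℤ) : finAdeleQ) ∈ levelIdeal N := by
    have e : ((a - a' : ℤ) : finAdeleQ) = ((u' : finAdeleQ) - a') - ((u : finAdeleQ) - a) + ((u : finAdeleQ) - u') := by
      push_cast; ring
    rw [e]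
    exact add_mem (sub_mem ha' ha) hsub
  exact (intCast_mem_levelIdeal_iff hN).1 hmem

end Disjoint

/-! ### §3a. Strong approximation, set form ⇒ sharp two-point form -/

section StrongApproximation

/-- **STRONG APPROXIMATION FOR `Sp_δ`, SHARP TWO-POINT FORM** (from the set form «`Sp_δ(𝔸_f) = Sp_δ(ℚ)·U` for every open
`U ∋ 1`», ★ R60-8 / R60-8c `exists_gspRational_mul_mem_of_isOpen`): two points `a, b ∈ GSp_δ(𝔸_f)` with a
COMMON multiplier satisfy `b = γ·a·k` with `γ ∈ Sp_δ(ℚ)` (multiplier `1`) and `k ∈ K_δ(N)` — apply the set form to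
`s = b a⁻¹ ∈ Sp_δ(𝔸_f)` (★ `IsMultiplier.mul_inv_mem_symplecticGroupOfForm`) and the open neighbourhood
`U = {y | a⁻¹ y a ∈ K_δ(N)}` of `1` (★ `isOpen_principalLevelSubgroup`). [cite: Milne2005ShimuraVarieties, Lemma 5.12 p. 57 and Thm. 5.17 p. 59]
[cite: PlatonovRapinchuk1994, §7.4 Thm. 7.12] -/
theorem exists_symplectic_rational_mul_mul_of_isMultiplier (hδ : ∀ i, 0 < δ i) {N : ℕ} (hN : N ≠ 0)
    {a b : gspFinAdelic δ} {ν : finAdeleQˣ}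
    (ha : IsMultiplier (typeFormOver δ finAdeleQ) (a : GL (Fin g ⊕ Fin g) finAdeleQ) ν)
    (hb : IsMultiplier (typeFormOver δ finAdeleQ) (b : GL (Fin g ⊕ Fin g) finAdeleQ) ν) :
    ∃ γ : gspRational δ, (γ : GL (Fin g ⊕ Fin g) ℚ) ∈ symplecticGroupOfForm (typeFormOver δ ℚ) ∧
      ∃ k ∈ principalLevelSubgroup δ N, b = gspRationalToFinAdelic δ γ * a * k := by
  -- the open neighbourhood `U = {y | a⁻¹ y a ∈ K_δ(N)}` of `1`
  let U : Set (gspFinAdelic δ) := (fun y => a⁻¹ * y * a) ⁻¹' (principalLevelSubgroup δ N : Set (gspFinAdelic δ))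
  have hU : IsOpen U :=
    (isOpen_principalLevelSubgroup δ hN).preimage ((continuous_const.mul continuous_id).mul continuous_const)
  have h1 : (1 : gspFinAdelic δ) ∈ U := by
    change a⁻¹ * 1 * a ∈ principalLevelSubgroup δ N
    rw [mul_one, inv_mul_cancel]
    exact one_mem _
  -- `s = b a⁻¹ ∈ Sp_δ(𝔸_f)`
  have hs : ((b * a⁻¹ : gspFinAdelic δ) : GL (Fin g ⊕ Fin g) finAdeleQ) ∈
      symplecticGroupOfForm (typeFormOver δ finAdeleQ) := hb.mul_inv_mem_symplecticGroupOfForm ha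
  obtain ⟨γ, hγ, hmem⟩ := exists_gspRational_mul_mem_of_isOpen δ hδ U hU h1 (b * a⁻¹) hs
  refine ⟨γ, hγ, a⁻¹ * ((gspRationalToFinAdelic δ γ)⁻¹ * (b * a⁻¹)) * a, hmem, ?_⟩
  group

end StrongApproximation

/-! ### §3. Surjectivity: every class is `[J(Z), r_c·K_δ(N)]` (strong approximation for `Sp_δ`, sharp form) -/

section Surjective

/-- **Every class on `X⁺` has an integral diagonal representative of the family** ([Milne ISV] Lemma 5.13 footnote 41 «Now
`[x, a] = [q⁻¹x, g]`», for `GSp_δ` at principal level): given representatives `r_c` (`c ∈ (ℤ/N)^×`) with `ẑ`-unit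
multipliers `u_c ≡ c (mod N)`, every class `[J, aK_δ(N)]` with `J ∈ X⁺` equals `[J(Z), r_cK_δ(N)]` for some `c` and
`Z ∈ 𝔥_g`: normalise `ν(a) = q·u_c·w` (`q ∈ ℚ_{>0}`, `w ∈ ẑ^× ∩ (1+Nẑ)`, ★ R60-12), move by `diag(1,q) ∈ GSp_δ(ℚ)` and
`diag(1,w) ∈ K_δ(N)` (★ R60-20, ★ R60-4), then by strong approximation in the sharp form of §3a («common multiplier ⇒ same
class up to `Sp_δ(ℚ)` on the left», ★ R60-8 / R60-8c) `a′ = γ r_c k` with `ν(γ) = 1`, so the total rational factor has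
multiplier `q > 0` and keeps `J` in `X⁺` (★ `conjJ_mem_C0_of_pos`). [cite: Milne2005ShimuraVarieties, Lemma 5.13 p. 57 (proof: «a = qgk for some q ∈ G(ℚ)₊, g ∈ 𝒞, k ∈ K»), Lemma 5.12 p. 57, Thm. 5.17 p. 59]
[cite: Deligne1971TravauxShimura, Exemple 4.16 p. 150] -/
theorem SiegelShimuraSet.exists_eq_mk_jOfSiegel_of_mem_C0 (hδ : IsPolarizationType δ) {N : ℕ} (hN : N ≠ 0)
    {u : (ZMod N)ˣ → finAdeleQˣ} {rep : (ZMod N)ˣ → gspFinAdelic δ} (hu : ∀ c v, Valued.v ((u c : finAdeleQ) v) = 1)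
    (hua : ∀ c, (u c : finAdeleQ) - ((c : ZMod N).val : ℕ) ∈ levelIdeal N)
    (hrep : ∀ c, IsMultiplier (typeFormOver δ finAdeleQ) (rep c : GL (Fin g ⊕ Fin g) finAdeleQ) (u c))
    (J : C0pm δ) (hJ : (J : Matrix (Fin g ⊕ Fin g) (Fin g ⊕ Fin g) ℝ) ∈ C0 δ) (a : gspFinAdelic δ) :
    ∃ (c : (ZMod N)ˣ) (Z : siegelUpperHalfSpace g),
      SiegelShimuraSet.mk δ (principalLevelSubgroup δ N) J a =
        SiegelShimuraSet.mk δ (principalLevelSubgroup δ N) ⟨jOfSiegel δ Z, jOfSiegel_coe_mem_C0pm hδ.1 Z⟩ (rep c) := by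
  haveI : NeZero N := ⟨hN⟩
  -- the multiplier of `a` and its idèle-class invariant
  obtain ⟨x, hx⟩ := a.2
  obtain ⟨q₀, a₀, hq₀, hcop, hw, ha₀⟩ := exists_pos_rat_int_forall_valued_mul_eq_one_sub_intCast_mem_levelIdeal hN x
  have hunit : IsUnit (a₀ : ZMod N) := (ZMod.coe_int_isUnit_iff_isCoprime a₀ N).2 hcop.symm
  set c : (ZMod N)ˣ := hunit.unit with hc
  have hcval : (c : ZMod N) = (a₀ : ZMod N) := hunit.unit_spec
  have hdvd : (N : ℤ) ∣ (((c : ZMod N).val : ℕ) : ℤ) - a₀ := by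
    rw [← ZMod.intCast_eq_intCast_iff_dvd_sub, Int.cast_natCast, ZMod.natCast_zmod_val, hcval]
  -- `u_c = q · ν(a) · w` with `q > 0` rational and `w ∈ ẑ^× ∩ (1+Nẑ)`
  have hw1 : ∀ v, Valued.v ((algebraMap ℚ finAdeleQ 1 * (u c : finAdeleQ)) v) = 1 := fun v => by
    rw [map_one, one_mul]; exact hu c v
  have ha1 : algebraMap ℚ finAdeleQ 1 * (u c : finAdeleQ) - ((((c : ZMod N).val : ℕ) : ℤ) : finAdeleQ) ∈ levelIdeal N := by
    rw [map_one, one_mul, Int.cast_natCast]; exact hua c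
  obtain ⟨q, w, hq, hwu, hw1N, hw1N', huc⟩ := exists_eq_mul_mul_of_int_dvd_sub hN hq₀ hw ha₀ one_pos hw1 ha1 hdvd
  -- the movers `γ₀ = diag(1,q) ∈ GSp_δ(ℚ)` and `k₀ = diag(1,w) ∈ K_δ(N)`
  obtain ⟨d, hdmem, hdmul, -⟩ :=
    exists_mem_similitudeGroupOfForm_typeFormOver_isMultiplier δ ℚ (Units.mk0 q hq.ne')
  obtain ⟨k₀, hk₀K, hk₀mul, -⟩ := exists_mem_principalLevelSubgroup_isMultiplier δ w hw1N hw1N'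
  set γ₀ : gspRational δ := ⟨d, hdmem⟩ with hγ₀
  -- `a′ = γ₀ a k₀` has multiplier `u_c`
  have hνeq : Units.map (algebraMap ℚ finAdeleQ).toMonoidHom (Units.mk0 q hq.ne') * x * w = u c :=
    Units.ext (by
      change algebraMap ℚ finAdeleQ q * (x : finAdeleQ) * (w : finAdeleQ) = (u c : finAdeleQ)
      exact huc.symm)
  have ha' : IsMultiplier (typeFormOver δ finAdeleQ)
      ((gspRationalToFinAdelic δ γ₀ * a * k₀ : gspFinAdelic δ) : GL (Fin g ⊕ Fin g) finAdeleQ) (u c) := by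
    have h1 := hdmul.map (algebraMap ℚ finAdeleQ)
    rw [typeFormOver_map] at h1
    have h2 := (h1.mul hx).mul hk₀mul
    rw [hνeq] at h2
    exact h2
  -- STRONG APPROXIMATION (sharp form): `a′ = γ₁ r_c k₁`, `γ₁ ∈ Sp_δ(ℚ)`
  obtain ⟨γ₁, hγ₁, k₁, hk₁K, heq⟩ := exists_symplectic_rational_mul_mul_of_isMultiplier hδ.1 hN (hrep c) ha'
  -- the total rational factor `γ′ = γ₀⁻¹ γ₁` has multiplier `q⁻¹·1`, positive
  have hγ' : IsMultiplier (typeFormOver δ ℚ) ((γ₀⁻¹ * γ₁ : gspRational δ) : GL (Fin g ⊕ Fin g) ℚ)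
      ((Units.mk0 q hq.ne')⁻¹ * 1) := hdmul.inv.mul hγ₁
  have hγ'R : IsMultiplier (realTypeForm δ) ((gspRationalToReal δ (γ₀⁻¹ * γ₁)⁻¹ : gspReal δ) : GL (Fin g ⊕ Fin g) ℝ)
      (Units.map (algebraMap ℚ ℝ).toMonoidHom ((Units.mk0 q hq.ne')⁻¹ * 1)⁻¹) := by
    have := (hγ'.inv).map (algebraMap ℚ ℝ)
    rw [typeFormOver_map, typeFormOver_real_eq_realTypeForm] at this
    exact this
  have hpos : 0 < ((Units.map (algebraMap ℚ ℝ).toMonoidHom ((Units.mk0 q hq.ne')⁻¹ * 1)⁻¹ : ℝˣ) : ℝ) := by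
    rw [mul_one, inv_inv]
    change 0 < algebraMap ℚ ℝ q
    rw [eq_ratCast]
    exact_mod_cast hq
  -- the new complex structure `J″ = γ′⁻¹ • J ∈ X⁺`, `J″ = J(Z)`
  set J'' : C0pm δ := conjAct δ (gspRationalToReal δ (γ₀⁻¹ * γ₁)⁻¹) J with hJ''
  have hJ''C0 : (J'' : Matrix (Fin g ⊕ Fin g) (Fin g ⊕ Fin g) ℝ) ∈ C0 δ := by
    rw [hJ'', coe_conjAct]
    exact conjJ_mem_C0_of_pos hγ'R hpos hJ
  refine ⟨c, ⟨siegelOfJ δ J'', siegelOfJ_mem hJ''C0⟩, ?_⟩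
  -- `[J, a] = [J, γ′ r_c (k₁ k₀⁻¹)] = [γ′⁻¹•J, r_c]`
  have haeq : a = gspRationalToFinAdelic δ (γ₀⁻¹ * γ₁) * rep c * (k₁ * k₀⁻¹) := by
    have e1 : a = (gspRationalToFinAdelic δ γ₀)⁻¹ * (gspRationalToFinAdelic δ γ₀ * a * k₀) * k₀⁻¹ := by group
    rw [e1, heq, map_mul, map_inv]
    group
  have hJeq : (⟨jOfSiegel δ (siegelOfJ δ J''), jOfSiegel_coe_mem_C0pm hδ.1 ⟨siegelOfJ δ J'', siegelOfJ_mem hJ''C0⟩⟩ : C0pm δ) =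
      J'' := Subtype.ext (jOfSiegel_siegelOfJ hJ''C0 hδ.1)
  rw [hJeq, haeq, SiegelShimuraSet.mk_mul_of_mem δ _ J _ (mul_mem hk₁K (inv_mem hk₀K)), hJ'',
    ← SiegelShimuraSet.mk_conjAct_smul δ _ (γ₀⁻¹ * γ₁) (conjAct δ (gspRationalToReal δ (γ₀⁻¹ * γ₁)⁻¹) J),
    ← conjAct_mul, ← map_mul, mul_inv_cancel, map_one, conjAct_one]

/-- **Every class has an integral diagonal representative of the family, with `J ∈ X⁺`** — a class `[J, aK]` with `J ∈ X⁻` is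
first rewritten `[γ₀Jγ₀⁻¹, γ₀aK]` with the rational half-swap `γ₀ = diag(1_g, -1_g)` (★ `SiegelHalfSwap`, multiplier `-1`,
`γ₀Jγ₀⁻¹ ∈ X⁺`), then `exists_eq_mk_jOfSiegel_of_mem_C0` applies. [cite: Milne2005ShimuraVarieties, §6 p. 68 and Lemma 5.13 p. 57] -/
theorem SiegelShimuraSet.exists_eq_mk_jOfSiegel (hδ : IsPolarizationType δ) {N : ℕ} (hN : N ≠ 0)
    {u : (ZMod N)ˣ → finAdeleQˣ} {rep : (ZMod N)ˣ → gspFinAdelic δ} (hu : ∀ c v, Valued.v ((u c : finAdeleQ) v) = 1)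
    (hua : ∀ c, (u c : finAdeleQ) - ((c : ZMod N).val : ℕ) ∈ levelIdeal N)
    (hrep : ∀ c, IsMultiplier (typeFormOver δ finAdeleQ) (rep c : GL (Fin g ⊕ Fin g) finAdeleQ) (u c))
    (x : SiegelShimuraSet δ (principalLevelSubgroup δ N)) :
    ∃ (c : (ZMod N)ˣ) (Z : siegelUpperHalfSpace g),
      x = SiegelShimuraSet.mk δ (principalLevelSubgroup δ N) ⟨jOfSiegel δ Z, jOfSiegel_coe_mem_C0pm hδ.1 Z⟩ (rep c) := by
  obtain ⟨⟨J, a⟩, rfl⟩ := SiegelShimuraSet.mk_surjective δ (principalLevelSubgroup δ N) x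
  change ∃ c Z, SiegelShimuraSet.mk δ _ J a = _
  rcases mem_C0pm_iff.1 J.2 with hJ | hJ
  · exact SiegelShimuraSet.exists_eq_mk_jOfSiegel_of_mem_C0 hδ hN hu hua hrep J hJ a
  · -- move `J ∈ X⁻` to `X⁺` with the half-swap
    set h₀ : gspRational δ := ⟨halfSwap ℚ g, halfSwap_mem_gspRational δ⟩ with hh₀
    have hJ' : ((conjAct δ (gspRationalToReal δ h₀) J : C0pm δ) : Matrix (Fin g ⊕ Fin g) (Fin g ⊕ Fin g) ℝ) ∈ C0 δ := by
      rw [coe_conjAct, hh₀, gspRationalToReal_halfSwap]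
      exact conjJ_halfSwap_mem_C0 hJ
    obtain ⟨c, Z, hcZ⟩ := SiegelShimuraSet.exists_eq_mk_jOfSiegel_of_mem_C0 hδ hN hu hua hrep _ hJ'
      (gspRationalToFinAdelic δ h₀ * a)
    refine ⟨c, Z, ?_⟩
    rw [← hcZ, SiegelShimuraSet.mk_conjAct_smul]

end Surjective

/-! ### §4. The capstone: `(Σ c : (ℤ/N)^×, Γ_δ(N)∖𝔥_g) ≃ Sh_{K_δ(N)}(GSp_δ, S^±)(ℂ)` on a Siegel fine moduli datum -/

section Capstone

open Literature.AlgebraicGeometry.Motives (ComplexPoints)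

/-- **THE PRINCIPAL DISSECTION** ([Milne ISV] Lemma 5.13 + Thm. 5.17 for `GSp_δ` at level `K_δ(N)`, `N ≥ 3`, `0 < g`, `δ` a
polarisation type; [MFK94] App. 7A): for every Siegel fine moduli datum `D` of type `δ` and level `N` (so `D.S(ℂ) = Γ_δ(N)∖𝔥_g`,
★ `SiegelModuliDatum.unif_eq_unif_iff_exists_smul`), there are
`ẑ`-units `u_c` of residue `c` and integral representatives `r_c = diag(1_g, u_c·1_g) ∈ K_δ(1)` (`c ∈ (ℤ/N)^×`) and a BIJECTION
`e : (Σ c : (ℤ/N)^×, D.S(ℂ)) ≃ Sh_{K_δ(N)}(ℂ)` with `e ⟨c, [X_Z]⟩ = [J(Z), r_cK_δ(N)]` — injective on each piece by ★ R60-11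
(`mk_jOfSiegel_eq_mk_jOfSiegel_iff_unif_eq_unif`), pieces disjoint by §2, onto by §3.  This is the one-level content of the
fields `Q K`, `rep K q`, `pts K`, `incl_unif` of ★ (σ3) `SiegelComplexRecordSystem` for `Mc_K := ∐_c D.S`.
[cite: Milne2005ShimuraVarieties, Lemma 5.13 p. 57 and Thm. 5.17 p. 59; §6 p. 70] [cite: MumfordFogartyKirwan1994, Appendix to Ch. 7 §A]
[cite: Deligne1971TravauxShimura, Exemple 4.16 p. 150] -/
theorem SiegelModuliDatum.exists_sigma_equiv_siegelShimuraSet (hδ : IsPolarizationType δ) (hg : 0 < g) {N : ℕ}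
    (hN : 3 ≤ N)
    (D : SiegelModuliDatum g δ N) :
    ∃ (u : (ZMod N)ˣ → finAdeleQˣ) (rep : (ZMod N)ˣ → gspFinAdelic δ)
      (e : (Σ _ : (ZMod N)ˣ, ComplexPoints D.S) ≃ SiegelShimuraSet δ (principalLevelSubgroup δ N)),
      (∀ c, (∀ v, Valued.v ((u c : finAdeleQ) v) = 1) ∧ (u c : finAdeleQ) - ((c : ZMod N).val : ℕ) ∈ levelIdeal N ∧
        rep c ∈ principalLevelSubgroup δ 1 ∧
          IsMultiplier (typeFormOver δ finAdeleQ) (rep c : GL (Fin g ⊕ Fin g) finAdeleQ) (u c) ∧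
            ((rep c : GL (Fin g ⊕ Fin g) finAdeleQ) : Matrix (Fin g ⊕ Fin g) (Fin g ⊕ Fin g) finAdeleQ) =
              Matrix.fromBlocks 1 0 0 ((u c : finAdeleQ) • (1 : Matrix (Fin g) (Fin g) finAdeleQ))) ∧
      ∀ (c : (ZMod N)ˣ) (Z : siegelUpperHalfSpace g),
        e ⟨c, D.unif Z⟩ =
          SiegelShimuraSet.mk δ (principalLevelSubgroup δ N) ⟨jOfSiegel δ Z, jOfSiegel_coe_mem_C0pm hδ.1 Z⟩ (rep c) := by
  classical
  have hN0 : N ≠ 0 := by omega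
  haveI : NeZero N := ⟨hN0⟩
  -- representatives
  choose u rep hu hua hrep1 hrepmul hrepmat using fun c : (ZMod N)ˣ => exists_principalRep δ hN0 c
  -- a section of `unif`
  have hsec : ∀ P : ComplexPoints D.S, ∃ Z : siegelUpperHalfSpace g, D.unif Z = P := fun P => by
    obtain ⟨Z, hZ, hZP⟩ := D.exists_eq_unif P
    exact ⟨⟨Z, hZ⟩, hZP⟩
  choose σ hσ using hsec
  -- the map
  let f : (Σ _ : (ZMod N)ˣ, ComplexPoints D.S) → SiegelShimuraSet δ (principalLevelSubgroup δ N) := fun p =>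
    SiegelShimuraSet.mk δ (principalLevelSubgroup δ N) ⟨jOfSiegel δ (σ p.2), jOfSiegel_coe_mem_C0pm hδ.1 (σ p.2)⟩ (rep p.1)
  -- its value on moduli points
  have hf : ∀ (c : (ZMod N)ˣ) (Z : siegelUpperHalfSpace g), f ⟨c, D.unif Z⟩ =
      SiegelShimuraSet.mk δ (principalLevelSubgroup δ N) ⟨jOfSiegel δ Z, jOfSiegel_coe_mem_C0pm hδ.1 Z⟩ (rep c) := by
    intro c Z
    exact (SiegelShimuraSet.mk_jOfSiegel_eq_mk_jOfSiegel_iff_unif_eq_unif hδ hg hN D (hrep1 c) (σ (D.unif Z)) Z).2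
      ((hσ (D.unif Z)).symm ▸ rfl)
  -- injective
  have hinj : Function.Injective f := by
    rintro ⟨c, P⟩ ⟨c', P'⟩ hPP'
    have hcc' : c = c' := by
      have hres : (N : ℤ) ∣ (((c : ZMod N).val : ℕ) : ℤ) - (((c' : ZMod N).val : ℕ) : ℤ) :=
        intCast_dvd_sub_of_mk_jOfSiegel_eq_mk_jOfSiegel hδ hg hN0 (hrep1 c) (hrep1 c') (hrepmul c) (hrepmul c') (hu c')
          (by rw [Int.cast_natCast]; exact hua c) (by rw [Int.cast_natCast]; exact hua c') hPP'
      apply Units.ext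
      rw [← ZMod.natCast_zmod_val (c : ZMod N), ← ZMod.natCast_zmod_val (c' : ZMod N), ← Int.cast_natCast,
        ← Int.cast_natCast ((c' : ZMod N).val), ZMod.intCast_eq_intCast_iff_dvd_sub]
      have := Int.dvd_neg.2 hres
      rwa [neg_sub] at this
    subst hcc'
    have hPP : D.unif (σ P') = D.unif (σ P) :=
      (SiegelShimuraSet.mk_jOfSiegel_eq_mk_jOfSiegel_iff_unif_eq_unif hδ hg hN D (hrep1 c) (σ P) (σ P')).1 hPP'
    rw [hσ, hσ] at hPP
    rw [hPP]
  -- surjective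
  have hsurj : Function.Surjective f := by
    intro x
    obtain ⟨c, Z, rfl⟩ := SiegelShimuraSet.exists_eq_mk_jOfSiegel hδ hN0 hu hua hrepmul x
    exact ⟨⟨c, D.unif Z⟩, hf c Z⟩
  exact ⟨u, rep, Equiv.ofBijective f ⟨hinj, hsurj⟩, fun c => ⟨hu c, hua c, hrep1 c, hrepmul c, hrepmat c⟩,
    fun c Z => hf c Z⟩

end Capstone

end Literature.AlgebraicGeometry.ModuliOfAbelianVarieties

end
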